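import Summits.Parity.GeneralizedHardyLittlewood.Theorems.GreenTaoLevelTwoGITwoCyclicInverseQuadruples
import Summits.Parity.GeneralizedHardyLittlewood.Theorems.GreenTaoLevelTwoGITwoCyclicInverseBSG

/-!
# Route `GreenTaoLevelTwo`, crux `GITwo` (stmt-Parity-21275), line `birth`, stub `stub_cyclicInverse`:
# the derivative frequencies form a graph with small difference set (GT08a arXiv Prop. 27)

Ninth helper file toward the XL stub `stub_cyclicInverse` (B. Green, T. Tao, *An inverse theorem for
the Gowers `U³(G)` norm*, arXiv:math/0503014, Thm. 68 = PEMS 51 (2008) Thm. 12.8).  It closes the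
first section of the printed proof over `ℤ/Mℤ` — arXiv Prop. 27 "`h ↦ ξ_h` is nearly affine-linear" —
by chaining the landed bricks: Gowers' argument (`exists_shifts_freq_quadruples_of_gowersPower_three`,
file `…Quadruples`), the Balog–Szemerédi–Gowers theorem (`balog_szemeredi_gowers`, file `…BSG`) and
Mathlib's Plünnecke–Ruzsa inequality:

* `card_quadruples_le_addEnergy_graph` — the difference-form additive quadruples of `(t, ξ_t)` on
  `H` inject into the additive energy `E[Γ, Γ]` of the graph `Γ = {(t, ξ_t) : t ∈ H}` (Mathlib's
  `Finset.addEnergy`);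
* `exists_graph_small_difference` — **arXiv Prop. 27 (polynomial form)**: if `|f| ≤ 1` and
  `‖f‖_{U³(ℤ/Mℤ)}^8 ≥ ε > 0` there are `H' ⊆ ℤ/Mℤ` with `#H' ≥ ε¹⁷M/2²³` and `ξ` with
  `|(Δ_t f)^(ξ_t)|² ≥ ε/2` on `H'` whose graph `Γ'` has `#(Γ' − Γ') ≤ 2²²⁵ε⁻¹⁶⁸ #Γ'`
  (and `#Γ' = #H'`);
* `card_nsmul_sub_nsmul_graph_le` — the iterated sum-difference sets: `#(mΓ' − nΓ') ≤ K^{m+n} #Γ'`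
  with the same `K` (Plünnecke–Ruzsa).

Next (not here; census blocks B–C): Bohr sets in `ℤ/N'ℤ`, arXiv Lemma 44 and Prop. 43 (the graph
`4Γ'' − 4Γ''` is a graph; Bogolyubov (landed, file `…Bogolyubov`) on `H''`), Prop. 45.

References: [GreenTao2008U3Inverse] arXiv:math/0503014, Prop. 27 (from Prop. 24, Thm. 25, Thm. 26).
-/

noncomputable section

namespace Summit.Parity.GeneralizedHardyLittlewood.GreenTaoLevelTwoGITwoCyclicInverse

open Finset
open scoped Pointwise Combinatorics.Additive

open Literature.NumberTheory.Sieve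

variable {M : ℕ} [NeZero M]

omit [NeZero M] in
/-- The graph map `t ↦ (t, ξ_t)` is injective. [folklore] -/
theorem graph_injective (ξ : ZMod M → ZMod M) : Function.Injective fun t : ZMod M => (t, ξ t) :=
  fun _ _ h => congrArg Prod.fst h

omit [NeZero M] in
/-- **Difference quadruples inject into the additive energy of the graph**:
`#{(t₁,t₂,t₃,t₄) ∈ H⁴ : t₁ − t₂ = t₃ − t₄, ξ_{t₁} − ξ_{t₂} = ξ_{t₃} − ξ_{t₄}} ≤ E[Γ, Γ]`,
`Γ = {(t, ξ_t) : t ∈ H}`. [folklore] -/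
theorem card_quadruples_le_addEnergy_graph (H : Finset (ZMod M)) (ξ : ZMod M → ZMod M) :
    #{q ∈ (H ×ˢ H) ×ˢ (H ×ˢ H) |
        q.1.1 - q.1.2 = q.2.1 - q.2.2 ∧ ξ q.1.1 - ξ q.1.2 = ξ q.2.1 - ξ q.2.2} ≤
      E[H.image fun t => (t, ξ t), H.image fun t => (t, ξ t)] := by
  set Γ := H.image fun t => (t, ξ t) with hΓ
  have hmem : ∀ t ∈ H, (t, ξ t) ∈ Γ := fun t ht => mem_image_of_mem _ ht
  show _ ≤ #{x ∈ (Γ ×ˢ Γ) ×ˢ Γ ×ˢ Γ | x.1.1 + x.2.1 = x.1.2 + x.2.2}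
  refine Finset.card_le_card_of_injOn
    (fun q => (((q.1.1, ξ q.1.1), (q.1.2, ξ q.1.2)), ((q.2.2, ξ q.2.2), (q.2.1, ξ q.2.1)))) ?_ ?_
  · intro q hq
    rw [mem_coe, mem_filter, mem_product, mem_product, mem_product] at hq
    obtain ⟨⟨⟨h1, h2⟩, h3, h4⟩, hd, hξ⟩ := hq
    rw [mem_coe, mem_filter, mem_product, mem_product, mem_product]
    refine ⟨⟨⟨hmem _ h1, hmem _ h2⟩, hmem _ h4, hmem _ h3⟩, ?_⟩
    show (q.1.1, ξ q.1.1) + (q.2.2, ξ q.2.2) = (q.1.2, ξ q.1.2) + (q.2.1, ξ q.2.1)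
    rw [Prod.mk_add_mk, Prod.mk_add_mk, Prod.mk.injEq]
    constructor
    · linear_combination hd
    · linear_combination hξ
  · intro q _ q' _ h
    simp only [Prod.mk.injEq] at h
    obtain ⟨⟨⟨h1, -⟩, h2, -⟩, ⟨h4, -⟩, h3, -⟩ := h
    exact Prod.ext (Prod.ext h1 h2) (Prod.ext h3 h4)

omit [NeZero M] in
/-- A subset of a graph is the graph of the same function on its first projection. [folklore] -/
theorem eq_image_graph_of_subset (H : Finset (ZMod M)) (ξ : ZMod M → ZMod M)
    {Γ' : Finset (ZMod M × ZMod M)} (hΓ' : Γ' ⊆ H.image fun t => (t, ξ t)) :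
    Γ' = (Γ'.image Prod.fst).image fun t => (t, ξ t) := by
  ext p
  constructor
  · intro hp
    obtain ⟨t, -, rfl⟩ := mem_image.mp (hΓ' hp)
    exact mem_image.mpr ⟨t, mem_image.mpr ⟨(t, ξ t), hp, rfl⟩, rfl⟩
  · intro hp
    obtain ⟨t, ht, rfl⟩ := mem_image.mp hp
    obtain ⟨p, hp', rfl⟩ := mem_image.mp ht
    obtain ⟨s, -, rfl⟩ := mem_image.mp (hΓ' hp')
    exact hp'

/-- **GT08a arXiv Prop. 27 (polynomial form): the derivative frequencies have a large piece with
small difference set.**  If `|f| ≤ 1` on `ℤ/Mℤ` and `‖f‖_{U³}^8 ≥ ε > 0`, there are `H' ⊆ ℤ/Mℤ` and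
`ξ : ℤ/Mℤ → ℤ/Mℤ` with `#H' ≥ ε¹⁷M/2²³`, `|(Δ_t f)^(ξ_t)|² ≥ ε/2` for `t ∈ H'`, and the graph
`Γ' = {(t, ξ_t) : t ∈ H'}` satisfies `#(Γ' − Γ') ≤ 2²²⁵ ε⁻¹⁶⁸ · #Γ'` (`#Γ' = #H'`).
[cite: GreenTao2008U3Inverse, Prop. 27] -/
theorem exists_graph_small_difference {f : ZMod M → ℝ} (hf : ∀ x, |f x| ≤ 1) {ε : ℝ}
    (hε0 : 0 < ε) (hε : ε ≤ gowersPower 3 f) :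
    ∃ (H' : Finset (ZMod M)) (ξ : ZMod M → ZMod M),
      ε ^ 17 / 2 ^ 23 * M ≤ #H' ∧
      (∀ t ∈ H', ε / 2 ≤ ‖dftCoeff (fun y => f y * f (y + t)) (ξ t)‖ ^ 2) ∧
      #(H'.image fun t => (t, ξ t)) = #H' ∧
      (#((H'.image fun t => (t, ξ t)) - (H'.image fun t => (t, ξ t))) : ℝ) ≤
        2 ^ 225 / ε ^ 168 * #(H'.image fun t => (t, ξ t)) := by
  have hMpos : (0 : ℝ) < M := by exact_mod_cast Nat.pos_of_ne_zero (NeZero.ne M)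
  have hε1 : ε ≤ 1 := hε.trans (gowersPower_le_one 3 hf)
  obtain ⟨H, ξ, hH, hfreq, hQ⟩ := exists_shifts_freq_quadruples_of_gowersPower_three hf hε0 hε
  obtain ⟨Γ, hΓ⟩ : ∃ Γ : Finset (ZMod M × ZMod M), Γ = H.image fun t => (t, ξ t) := ⟨_, rfl⟩
  have hΓcard : #Γ = #H := by rw [hΓ]; exact card_image_of_injective _ (graph_injective ξ)
  have hHpos : (0 : ℝ) < #H := lt_of_lt_of_le (by positivity) hH
  have hΓne : Γ.Nonempty := by
    rw [← card_pos, hΓcard]; exact_mod_cast hHpos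
  have hHM : (#H : ℝ) ≤ M := by
    have := card_le_univ H
    rw [ZMod.card] at this
    exact_mod_cast this
  -- the energy of the graph
  obtain ⟨K, hK⟩ : ∃ K : ℝ, K = 256 / ε ^ 8 := ⟨_, rfl⟩
  have hK1 : 1 ≤ K := by
    rw [hK, le_div_iff₀ (by positivity)]
    have : ε ^ 8 ≤ 1 := pow_le_one₀ hε0.le hε1
    linarith
  have hEnergy : (#Γ : ℝ) ^ 3 / K ≤ (E[Γ, Γ] : ℝ) := by
    have h1 := card_quadruples_le_addEnergy_graph H ξ
    rw [← hΓ] at h1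
    have h2 : ε ^ 8 / 256 * (#Γ : ℝ) ^ 3 ≤ ε ^ 8 / 256 * (M : ℝ) ^ 3 := by
      rw [hΓcard]; gcongr
    calc (#Γ : ℝ) ^ 3 / K = ε ^ 8 / 256 * (#Γ : ℝ) ^ 3 := by rw [hK, div_div_eq_mul_div]; ring
      _ ≤ ε ^ 8 / 256 * (M : ℝ) ^ 3 := h2
      _ ≤ _ := hQ
      _ ≤ (E[Γ, Γ] : ℝ) := by exact_mod_cast h1
  -- Balog–Szemerédi–Gowers
  obtain ⟨Γ', hΓ'Γ, hΓ'card, hΓ'diff⟩ := balog_szemeredi_gowers Γ hΓne hK1 hEnergy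
  obtain ⟨H', hH'⟩ : ∃ H' : Finset (ZMod M), H' = Γ'.image Prod.fst := ⟨_, rfl⟩
  have hΓ'sub : Γ' ⊆ H.image fun t => (t, ξ t) := by rw [← hΓ]; exact hΓ'Γ
  have hgraph : Γ' = H'.image fun t => (t, ξ t) := by
    rw [hH']; exact eq_image_graph_of_subset H ξ hΓ'sub
  have hH'card : #(H'.image fun t => (t, ξ t)) = #H' := card_image_of_injective _ (graph_injective ξ)
  have hH'H : H' ⊆ H := by
    intro t ht
    rw [hH'] at ht
    obtain ⟨p, hp, rfl⟩ := mem_image.mp ht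
    obtain ⟨s, hs, hsp⟩ := mem_image.mp (hΓ'sub hp)
    rw [← hsp]; exact hs
  refine ⟨H', ξ, ?_, fun t ht => hfreq t (hH'H ht), hH'card, ?_⟩
  · -- `#H' = #Γ' ≥ #Γ/(48K²) = ε¹⁶ #H/(48·2¹⁶) ≥ ε¹⁷ M/2²³`
    rw [← hH'card, ← hgraph]
    refine le_trans ?_ hΓ'card
    rw [hΓcard, hK]
    have h1 : ((#H : ℝ)) / (48 * (256 / ε ^ 8) ^ 2) = ε ^ 16 * #H / (48 * 256 ^ 2) := by
      rw [div_pow, ← pow_mul, mul_div_assoc', div_div_eq_mul_div]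
      ring
    rw [h1]
    have h2 : ε ^ 17 / 2 ^ 23 * (M : ℝ) ≤ ε ^ 16 * (ε / 2 * M) / 2 ^ 22 := by
      have : ε ^ 16 * (ε / 2 * (M : ℝ)) / 2 ^ 22 = ε ^ 17 / 2 ^ 23 * M := by ring
      rw [this]
    refine h2.trans ?_
    have h3 : ε ^ 16 * (ε / 2 * (M : ℝ)) / 2 ^ 22 ≤ ε ^ 16 * #H / 2 ^ 22 := by
      gcongr
    refine h3.trans ?_
    have hnum : (0 : ℝ) ≤ ε ^ 16 * #H := mul_nonneg (pow_nonneg hε0.le 16) (Nat.cast_nonneg _)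
    have hc : (0 : ℝ) < 48 * 256 ^ 2 := by norm_num
    have hle : (48 : ℝ) * 256 ^ 2 ≤ 2 ^ 22 := by norm_num
    exact div_le_div_of_nonneg_left hnum hc hle
  · rw [← hgraph]
    refine hΓ'diff.trans (le_of_eq ?_)
    rw [hK, div_pow, ← pow_mul]
    ring

/-- **Iterated sum-difference sets of the graph** (Plünnecke–Ruzsa, Mathlib): if
`#(Γ' − Γ') ≤ K · #Γ'` then `#(mΓ' − nΓ') ≤ K^{m+n} · #Γ'` for all `m, n`.
[cite: GreenTao2008U3Inverse, Thm. 26 (Plünnecke inequalities)] -/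
theorem card_nsmul_sub_nsmul_le {G : Type*} [AddCommGroup G] [DecidableEq G] (Γ' : Finset G)
    (hne : Γ'.Nonempty) {K : ℝ} (hK : (#(Γ' - Γ') : ℝ) ≤ K * #Γ') (m n : ℕ) :
    (#(m • Γ' - n • Γ') : ℝ) ≤ K ^ (m + n) * #Γ' := by
  have hpos : (0 : ℝ) < #Γ' := by exact_mod_cast hne.card_pos
  have h := Finset.pluennecke_ruzsa_inequality_nsmul_sub_nsmul_sub hne Γ' m n
  -- move the `ℚ≥0` inequality to `ℝ`
  have h' : ((#(m • Γ' - n • Γ') : ℚ≥0) : ℝ) ≤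
      (((#(Γ' - Γ') / #Γ' : ℚ≥0) ^ (m + n) * #Γ' : ℚ≥0) : ℝ) := by exact_mod_cast h
  have h'' : (#(m • Γ' - n • Γ') : ℝ) ≤ ((#(Γ' - Γ') : ℝ) / #Γ') ^ (m + n) * #Γ' := by
    have e1 : ((#(m • Γ' - n • Γ') : ℚ≥0) : ℝ) = (#(m • Γ' - n • Γ') : ℝ) := by norm_cast
    have e2 : (((#(Γ' - Γ') / #Γ' : ℚ≥0) ^ (m + n) * #Γ' : ℚ≥0) : ℝ) =
        ((#(Γ' - Γ') : ℝ) / #Γ') ^ (m + n) * #Γ' := by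
      push_cast
      rfl
    rw [e1, e2] at h'
    exact h'
  refine h''.trans ?_
  have hratio : (#(Γ' - Γ') : ℝ) / #Γ' ≤ K := by
    rw [div_le_iff₀ hpos]; exact hK
  have hratio0 : 0 ≤ (#(Γ' - Γ') : ℝ) / #Γ' := by positivity
  exact mul_le_mul_of_nonneg_right (pow_le_pow_left₀ hratio0 hratio _) hpos.le

end Summit.Parity.GeneralizedHardyLittlewood.GreenTaoLevelTwoGITwoCyclicInverse
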